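import Summits.HodgeConjecture.HodgeConjecture.Theorems.CYFormCasimirCYFormCarrierEightRhoPairing
import Summits.HodgeConjecture.HodgeConjecture.Theorems.CYFormCasimirCYFormSquarePrincipleCoord
import HarnessLib

/-!
# Crux X1 `CYFormCarrierEight` (route `CYFormCasimir`, stmt-HodgeConjecture-23493), helper file 12:
# the Weil-frame calculus for an ARBITRARY basis of `W`

research route conditional on HC_CM; not a corollary. Nothing here proves HC, HC_CM, the rung H2, X1 or
`stub_cyform_exists`; step S2 of `Cruxes/CYFormCarrierEight/STUB-PLAN-stub_cyform_exists.md` (the Hodge star by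
`β/ρ`-duality) needs the frame lemmas of X3's helper file 2 (`…SquarePrincipleCoord`) and of helper file 8
(`…BetaPairing`) for a GENERAL Weil frame `weilBasis … w` (`w` any basis of `W = ker(φ^* - i√d)`, `w^*` its
`Q_{h_K}`-dual basis of `W^*`), not only for the tree's fixed frame `bW` (`w = wBasis`): the Lagrangian step S4
works in a frame adapted to a `K`-stable Lagrangian subspace. The proofs are those of the cited files, verbatim
up to the basis parameter.

For a complex abelian eightfold `A`, `φ ≫ φ = -d` (`d > 0`), the `K`-symmetrised class `h_K = d·e^*a + φ^*e^*a` and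
a frame `b = weilBasis … w = (w, w^*)`:
* `testOp_frame_castAdd/natAdd`, `testOp_monB_frame`, `repr_testOp_frame` — `(x·𝟙 + y·φ)^*` is diagonal on the
  monomials `b_s`, eigenvalue `(x + iy√d)^{a(s)} (x - iy√d)^{b(s)}`;
* `repr_frame_eq_zero_of_mem_weilClassesPlus_two` (`…Minus…`), `monB_frame_mem_weilClassesPlus_two` (`…Minus…`),
  `weilClassesPlus_two_le_span_frame` (`…Minus…`) — `⋀⁴W` (`⋀⁴W^*`) is spanned by the `w`- (`w^*`-) monomials
  and has no other coordinates;
* `cup_frame_castAdd_eq_zero_of_ne_compl`, `cup_frame_natAdd_eq_zero_of_ne_compl` — `w_K ∪ w_I = 0`,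
  `w^*_K ∪ w^*_I = 0` unless `K = Iᶜ`; `cupProduct_comm_four` — graded commutativity in degree `4 + 4`;
* `beta_frame_eq_zero_of_ne` — under `Hg = SU_H`, `β(w_I, w^*_K) = tr((w_I ∪ w^*_K) ∪ h_K⁴) = 0` for `I ≠ K`
  (torus elements of `SU_H(ℂ)` in the frame `w`).

References: vanGeemen1994HodgeAV (4.9, Lemma 6.10, proof of Thm. 6.12), FriedmanLaza2013 (§3.5 Lemma 36),
LangeBirkenhake1992 (Lemma 1.1.17), HatcherAT2002 (§3.2 Prop. 3.10, Thm. 3.11).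
-/

-- `Summit.HodgeConjecture.HodgeConjecture.…` is the tree's mandated summit/problem namespace (single-problem summit).
set_option linter.dupNamespace false
noncomputable section

open CategoryTheory
open Literature.AlgebraicTopology.SingularHomology
open Literature.AlgebraicGeometry.Motives
open Literature.AlgebraicGeometry.HodgeTheory
open Literature.AlgebraicGeometry.VanGeemen1994

namespace Summit.HodgeConjecture.HodgeConjecture.Theorems.CYFormCarrier

section Frame

variable {A : AbelianVariety ℂ} {d : ℕ} {φ : A ⟶ A}
variable (hd : 0 < d) (hA : A.dim = 2 * 4) (hφ : φ ≫ φ = -(d • 𝟙 A))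
  (e : ProjectiveEmbedding A.X) {a : complexBetti (projectiveSpace e.n ℂ) 2} (ha : IsRationalClass a)
  (ha0 : a ≠ 0) (w : Module.Basis (Fin (2 * 4)) ℂ (eigW A φ d))
  (b : Module.Basis (Fin (2 * 4 + 2 * 4)) ℂ (complexBetti A.X 1))
  (hb : b = weilBasis (m := 2 * 4 - 1) (k := 2 * 4) (by omega) (by omega) hd hφ e ha ha0 w)

/-! ## §1 The test pull-backs on the monomials of a general frame -/

include hb in
/-- `(x·𝟙 + y·φ)^* wᵢ = (x + iy√d) wᵢ` on the first block of any Weil frame. [cite: vanGeemen1994HodgeAV, 4.9 and Lemma 6.10] -/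
theorem testOp_frame_castAdd (x y : ℕ) (i : Fin (2 * 4)) :
    (complexBetti.map (x • 𝟙 A + y • φ).hom.hom.hom 1).hom (b (Fin.castAdd (2 * 4) i)) =
      ((x : ℂ) + (y : ℂ) * Complex.I * (Real.sqrt d : ℂ)) • b (Fin.castAdd (2 * 4) i) := by
  change complexBetti.map (x • 𝟙 A + y • φ).hom.hom.hom 1 _ = _
  rw [complexBetti_map_nsmul_id_add_nsmul_one φ x y]
  have h := pullbackOne_weilBasis_castAdd (m := 2 * 4 - 1) (by omega) (by omega) hd hφ e ha ha0 w i
  rw [← hb] at h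
  change complexBetti.map φ.hom.hom.hom 1 (b (Fin.castAdd (2 * 4) i)) = _ at h
  rw [h, smul_smul, ← add_smul, mul_assoc]

include hb in
/-- `(x·𝟙 + y·φ)^* w*ⱼ = (x - iy√d) w*ⱼ` on the second block of any Weil frame. [cite: vanGeemen1994HodgeAV, 4.9 and Lemma 6.10] -/
theorem testOp_frame_natAdd (x y : ℕ) (j : Fin (2 * 4)) :
    (complexBetti.map (x • 𝟙 A + y • φ).hom.hom.hom 1).hom (b (Fin.natAdd (2 * 4) j)) =
      ((x : ℂ) - (y : ℂ) * Complex.I * (Real.sqrt d : ℂ)) • b (Fin.natAdd (2 * 4) j) := by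
  change complexBetti.map (x • 𝟙 A + y • φ).hom.hom.hom 1 _ = _
  rw [complexBetti_map_nsmul_id_add_nsmul_one φ x y]
  have h := pullbackOne_weilBasis_natAdd (m := 2 * 4 - 1) (by omega) (by omega) hd hφ e ha ha0 w j
  rw [← hb] at h
  change complexBetti.map φ.hom.hom.hom 1 (b (Fin.natAdd (2 * 4) j)) = _ at h
  rw [h, smul_smul, ← add_smul, mul_neg, ← sub_eq_add_neg, mul_assoc]

include hb in
/-- **The test pull-backs are diagonal on the monomials of any Weil frame**:
`(x·𝟙 + y·φ)^* b_s = (x + iy√d)^{a(s)} (x - iy√d)^{b(s)} b_s`. [cite: vanGeemen1994HodgeAV, 4.9 and proof of Thm. 6.12] -/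
theorem testOp_monB_frame (x y q : ℕ) (s : Set.powersetCard (Fin (2 * 4 + 2 * 4)) q) :
    complexBetti.map (x • 𝟙 A + y • φ).hom.hom.hom q (monB b q s) =
      (((x : ℂ) + (y : ℂ) * Complex.I * (Real.sqrt d : ℂ)) ^ (projW s.val).card *
        ((x : ℂ) - (y : ℂ) * Complex.I * (Real.sqrt d : ℂ)) ^
          (Finset.univ.filter fun j : Fin (2 * 4) ↦ Fin.natAdd (2 * 4) j ∈ s.val).card) •
      monB b q s := by
  change (complexBetti.map (x • 𝟙 A + y • φ).hom.hom.hom q).hom _ = _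
  rw [CYFormSquare.testOp_eq_extAct, extAct_monB_of_diagonal b _
    (fun j ↦ Fin.addCases (fun _ : Fin (2 * 4) ↦ (x : ℂ) + (y : ℂ) * Complex.I * (Real.sqrt d : ℂ))
      (fun _ : Fin (2 * 4) ↦ (x : ℂ) - (y : ℂ) * Complex.I * (Real.sqrt d : ℂ)) j), CYFormSquare.prod_addCases_const]
  intro j
  refine Fin.addCases (fun i ↦ ?_) (fun i ↦ ?_) j
  · rw [Fin.addCases_left]; exact testOp_frame_castAdd hd hA hφ e ha ha0 w b hb x y i
  · rw [Fin.addCases_right]; exact testOp_frame_natAdd hd hA hφ e ha ha0 w b hb x y i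

include hb in
/-- Coordinates under a test pull-back in any Weil frame: `((x·𝟙 + y·φ)^* z)_s = χ₊ᵃ⁽ˢ⁾ χ₋ᵇ⁽ˢ⁾ · z_s`.
[cite: vanGeemen1994HodgeAV, proof of Thm. 6.12] -/
theorem repr_testOp_frame (x y q : ℕ) (z : complexBetti A.X q) (s : Set.powersetCard (Fin (2 * 4 + 2 * 4)) q) :
    (monB b q).repr (complexBetti.map (x • 𝟙 A + y • φ).hom.hom.hom q z) s =
      (((x : ℂ) + (y : ℂ) * Complex.I * (Real.sqrt d : ℂ)) ^ (projW s.val).card *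
        ((x : ℂ) - (y : ℂ) * Complex.I * (Real.sqrt d : ℂ)) ^
          (Finset.univ.filter fun j : Fin (2 * 4) ↦ Fin.natAdd (2 * 4) j ∈ s.val).card) *
      (monB b q).repr z s :=
  CYFormSquare.repr_apply_of_diagonal (monB b q) (complexBetti.map (x • 𝟙 A + y • φ).hom.hom.hom q).hom _
    (fun t ↦ testOp_monB_frame hd hA hφ e ha ha0 w b hb x y q t) z s

/-! ## §2 `⋀⁴W`, `⋀⁴W^*` in the coordinates of a general frame -/

include hb hd in
/-- **A class of `⋀⁴W` has no coordinate at a monomial with a `w^*`-factor**, in any Weil frame.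
[cite: vanGeemen1994HodgeAV, 4.9 and proof of Thm. 6.12] -/
theorem repr_frame_eq_zero_of_mem_weilClassesPlus_two {c : complexBetti A.X (2 * 2)}
    (hc : c ∈ weilClassesPlus A φ 2 d) (s : Set.powersetCard (Fin (2 * 4 + 2 * 4)) (2 * 2))
    (hs : (Finset.univ.filter fun j : Fin (2 * 4) ↦ Fin.natAdd (2 * 4) j ∈ s.val).card ≠ 0) :
    (monB b (2 * 2)).repr c s = 0 := by
  set α : ℂ := ((1 : ℕ) : ℂ) + ((2 : ℕ) : ℂ) * Complex.I * (Real.sqrt d : ℂ) with hα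
  set β : ℂ := ((1 : ℕ) : ℂ) - ((2 : ℕ) : ℂ) * Complex.I * (Real.sqrt d : ℂ) with hβ
  set p := (projW s.val).card with hp
  set q := (Finset.univ.filter fun j : Fin (2 * 4) ↦ Fin.natAdd (2 * 4) j ∈ s.val).card with hq
  have hpq : p + q = 2 * 2 := by rw [hp, hq, ← CYFormSquare.card_eq_card_projW_add]; exact s.prop
  have h1 := repr_testOp_frame hd hA hφ e ha ha0 w b hb 1 2 (2 * 2) c s
  rw [(mem_weilClassesPlus_iff.1 hc) 1 2, map_smul, Finsupp.smul_apply, smul_eq_mul] at h1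
  have h2 : (α ^ (2 * 2) - α ^ p * β ^ q) * (monB b (2 * 2)).repr c s = 0 := by
    rw [sub_mul, h1, sub_self]
  refine (mul_eq_zero.1 h2).resolve_left (sub_ne_zero.2 fun h ↦ ?_)
  have hα0 : α ≠ 0 := by rw [hα]; push_cast; exact CYFormSquare.one_add_two_I_sqrt_ne_zero d
  have h3 : α ^ p * α ^ q = α ^ p * β ^ q := by rw [← pow_add, hpq, h]
  have h4 : α ^ q = β ^ q := mul_left_cancel₀ (pow_ne_zero _ hα0) h3
  have hq1 : 1 ≤ q := Nat.one_le_iff_ne_zero.2 hs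
  have hq4 : q ≤ 4 := by omega
  refine CYFormSquare.one_add_pow_ne_one_sub_pow hd hq1 hq4 ?_
  rw [hα, hβ] at h4; push_cast at h4; exact h4

include hb hd in
/-- **A class of `⋀⁴W^*` has no coordinate at a monomial with a `w`-factor**, in any Weil frame.
[cite: vanGeemen1994HodgeAV, 4.9 and proof of Thm. 6.12] -/
theorem repr_frame_eq_zero_of_mem_weilClassesMinus_two {c : complexBetti A.X (2 * 2)}
    (hc : c ∈ weilClassesMinus A φ 2 d) (s : Set.powersetCard (Fin (2 * 4 + 2 * 4)) (2 * 2))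
    (hs : (projW s.val).card ≠ 0) :
    (monB b (2 * 2)).repr c s = 0 := by
  set α : ℂ := ((1 : ℕ) : ℂ) + ((2 : ℕ) : ℂ) * Complex.I * (Real.sqrt d : ℂ) with hα
  set β : ℂ := ((1 : ℕ) : ℂ) - ((2 : ℕ) : ℂ) * Complex.I * (Real.sqrt d : ℂ) with hβ
  set p := (projW s.val).card with hp
  set q := (Finset.univ.filter fun j : Fin (2 * 4) ↦ Fin.natAdd (2 * 4) j ∈ s.val).card with hq
  have hpq : p + q = 2 * 2 := by rw [hp, hq, ← CYFormSquare.card_eq_card_projW_add]; exact s.prop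
  have h1 := repr_testOp_frame hd hA hφ e ha ha0 w b hb 1 2 (2 * 2) c s
  rw [(mem_weilClassesMinus_iff.1 hc) 1 2, map_smul, Finsupp.smul_apply, smul_eq_mul] at h1
  have h2 : (β ^ (2 * 2) - α ^ p * β ^ q) * (monB b (2 * 2)).repr c s = 0 := by
    rw [sub_mul, h1, sub_self]
  refine (mul_eq_zero.1 h2).resolve_left (sub_ne_zero.2 fun h ↦ ?_)
  have hβ0 : β ≠ 0 := by rw [hβ]; push_cast; exact CYFormSquare.one_sub_two_I_sqrt_ne_zero d
  have h3 : β ^ p * β ^ q = α ^ p * β ^ q := by rw [← pow_add, hpq, h]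
  have h4 : β ^ p = α ^ p := mul_right_cancel₀ (pow_ne_zero _ hβ0) h3
  have hp1 : 1 ≤ p := Nat.one_le_iff_ne_zero.2 hs
  have hp4 : p ≤ 4 := by omega
  refine CYFormSquare.one_add_pow_ne_one_sub_pow hd hp1 hp4 ?_
  rw [hα, hβ] at h4; push_cast at h4; exact h4.symm

include hb in
/-- A monomial of a general frame without `w^*`-factors lies in `⋀⁴W`. [cite: vanGeemen1994HodgeAV, proof of Thm. 6.12] -/
theorem monB_frame_mem_weilClassesPlus_two (s : Set.powersetCard (Fin (2 * 4 + 2 * 4)) (2 * 2))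
    (hs : (Finset.univ.filter fun j : Fin (2 * 4) ↦ Fin.natAdd (2 * 4) j ∈ s.val).card = 0) :
    monB b (2 * 2) s ∈ weilClassesPlus A φ 2 d := by
  rw [mem_weilClassesPlus_iff]
  intro x y
  have h := testOp_monB_frame hd hA hφ e ha ha0 w b hb x y (2 * 2) s
  have hp : (projW s.val).card = 2 * 2 := by
    have := CYFormSquare.card_eq_card_projW_add s.val; rw [hs, add_zero, s.prop] at this; exact this.symm
  rw [hs, hp, pow_zero, mul_one] at h
  exact h

include hb in
/-- A monomial of a general frame without `w`-factors lies in `⋀⁴W^*`. [cite: vanGeemen1994HodgeAV, proof of Thm. 6.12] -/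
theorem monB_frame_mem_weilClassesMinus_two (s : Set.powersetCard (Fin (2 * 4 + 2 * 4)) (2 * 2))
    (hs : (projW s.val).card = 0) :
    monB b (2 * 2) s ∈ weilClassesMinus A φ 2 d := by
  rw [mem_weilClassesMinus_iff]
  intro x y
  have h := testOp_monB_frame hd hA hφ e ha ha0 w b hb x y (2 * 2) s
  have hq : (Finset.univ.filter fun j : Fin (2 * 4) ↦ Fin.natAdd (2 * 4) j ∈ s.val).card = 2 * 2 := by
    have := CYFormSquare.card_eq_card_projW_add s.val; rw [hs, zero_add, s.prop] at this; exact this.symm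
  rw [hs, hq, pow_zero, one_mul] at h
  exact h

include hb in
/-- The monomial `w_I` (first block) of a general frame lies in `⋀⁴W`. [cite: vanGeemen1994HodgeAV, proof of Thm. 6.12] -/
theorem monB_frame_castAdd_mem_weilClassesPlus (I : Set.powersetCard (Fin (2 * 4)) (2 * 2)) :
    monB b (2 * 2) (Set.powersetCard.map (2 * 2) (Fin.castAddEmb (2 * 4)) I) ∈ weilClassesPlus A φ 2 d := by
  classical
  refine monB_frame_mem_weilClassesPlus_two hd hA hφ e ha ha0 w b hb _ ?_
  rw [Finset.card_eq_zero, Finset.filter_eq_empty_iff]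
  intro j _
  rw [Set.powersetCard.val_map]
  exact CYFormSquare.natAdd_not_mem_map_castAddEmb'

include hb in
/-- The monomial `w^*_K` (second block) of a general frame lies in `⋀⁴W^*`. [cite: vanGeemen1994HodgeAV, proof of Thm. 6.12] -/
theorem monB_frame_natAdd_mem_weilClassesMinus (K : Set.powersetCard (Fin (2 * 4)) (2 * 2)) :
    monB b (2 * 2) (Set.powersetCard.map (2 * 2) (Fin.natAddEmb (2 * 4)) K) ∈ weilClassesMinus A φ 2 d := by
  classical
  refine monB_frame_mem_weilClassesMinus_two hd hA hφ e ha ha0 w b hb _ ?_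
  rw [Finset.card_eq_zero]
  ext i
  simp only [Finset.notMem_empty, iff_false]
  rw [CYFormSquare.mem_projW_iff, Set.powersetCard.val_map]
  exact CYFormSquare.castAdd_not_mem_map_natAddEmb'

include hb hd in
/-- **`⋀⁴W` is spanned by the `w`-monomials of any Weil frame.** [cite: vanGeemen1994HodgeAV, proof of Thm. 6.12] -/
theorem weilClassesPlus_two_le_span_frame :
    weilClassesPlus A φ 2 d ≤ Submodule.span ℂ (Set.range fun I : Set.powersetCard (Fin (2 * 4)) (2 * 2) ↦
      monB b (2 * 2) (Set.powersetCard.map (2 * 2) (Fin.castAddEmb (2 * 4)) I)) := by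
  classical
  intro c hc
  set B := monB b (2 * 2) with hB
  rw [← B.sum_repr c]
  refine Submodule.sum_mem _ fun s _ ↦ ?_
  by_cases hs : (Finset.univ.filter fun j : Fin (2 * 4) ↦ Fin.natAdd (2 * 4) j ∈ s.val).card = 0
  · have hcard : (projW s.val).card = 2 * 2 := by
      have := CYFormSquare.card_eq_card_projW_add s.val; rw [hs, add_zero, s.prop] at this; exact this.symm
    have hst : Set.powersetCard.map (2 * 2) (Fin.castAddEmb (2 * 4)) (Set.powersetCard.ofCard hcard) = s :=
      Subtype.ext (by
        rw [Set.powersetCard.val_map, Set.powersetCard.val_ofCard]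
        exact (CYFormSquare.eq_map_castAddEmb_projW hs).symm)
    refine Submodule.smul_mem _ _ (Submodule.subset_span ⟨Set.powersetCard.ofCard hcard, ?_⟩)
    change monB b (2 * 2) _ = B s
    rw [hst]
  · rw [repr_frame_eq_zero_of_mem_weilClassesPlus_two hd hA hφ e ha ha0 w b hb hc s hs, zero_smul]
    exact Submodule.zero_mem _

include hb hd in
/-- **`⋀⁴W^*` is spanned by the `w^*`-monomials of any Weil frame.** [cite: vanGeemen1994HodgeAV, proof of Thm. 6.12] -/
theorem weilClassesMinus_two_le_span_frame :
    weilClassesMinus A φ 2 d ≤ Submodule.span ℂ (Set.range fun J : Set.powersetCard (Fin (2 * 4)) (2 * 2) ↦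
      monB b (2 * 2) (Set.powersetCard.map (2 * 2) (Fin.natAddEmb (2 * 4)) J)) := by
  classical
  intro c hc
  set B := monB b (2 * 2) with hB
  rw [← B.sum_repr c]
  refine Submodule.sum_mem _ fun s _ ↦ ?_
  by_cases hs : (projW s.val).card = 0
  · have hcard : (Finset.univ.filter fun j : Fin (2 * 4) ↦ Fin.natAdd (2 * 4) j ∈ s.val).card = 2 * 2 := by
      have := CYFormSquare.card_eq_card_projW_add s.val; rw [hs, zero_add, s.prop] at this; exact this.symm
    have hst : Set.powersetCard.map (2 * 2) (Fin.natAddEmb (2 * 4)) (Set.powersetCard.ofCard hcard) = s :=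
      Subtype.ext (by
        rw [Set.powersetCard.val_map, Set.powersetCard.val_ofCard]
        exact (CYFormSquare.eq_map_natAddEmb_filter hs).symm)
    refine Submodule.smul_mem _ _ (Submodule.subset_span ⟨Set.powersetCard.ofCard hcard, ?_⟩)
    change monB b (2 * 2) _ = B s
    rw [hst]
  · rw [repr_frame_eq_zero_of_mem_weilClassesMinus_two hd hA hφ e ha ha0 w b hb hc s hs, zero_smul]
    exact Submodule.zero_mem _

/-! ## §3 Products of monomials: vanishing for a shared factor, graded commutativity -/

/-- **`w_K ∪ w_I = 0` unless `K = Iᶜ`**, in any frame (a shared factor squares to zero). [cite: LangeBirkenhake1992, Lemma 1.1.17] -/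
theorem cup_frame_castAdd_eq_zero_of_ne_compl (hqk : 2 * 2 + 2 * 2 = Fintype.card (Fin (2 * 4)))
    (I K : Set.powersetCard (Fin (2 * 4)) (2 * 2)) (h : K ≠ Set.powersetCard.compl hqk I) :
    cupProduct (show 2 * 2 + 2 * 2 = 2 * 4 from rfl)
        (monB b (2 * 2) (Set.powersetCard.map (2 * 2) (Fin.castAddEmb (2 * 4)) K))
        (monB b (2 * 2) (Set.powersetCard.map (2 * 2) (Fin.castAddEmb (2 * 4)) I)) = 0 := by
  obtain ⟨j, hjK, hjI⟩ := exists_mem_mem_of_ne_compl hqk I K h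
  refine CYFormSquare.cupProduct_monB_monB_eq_zero_of_mem _ _ _ _ (j := Fin.castAdd (2 * 4) j) ?_ ?_
  · rw [Set.powersetCard.val_map]; exact Finset.mem_map_of_mem _ hjK
  · rw [Set.powersetCard.val_map]; exact Finset.mem_map_of_mem _ hjI

/-- **`w^*_K ∪ w^*_I = 0` unless `K = Iᶜ`**, in any frame. [cite: LangeBirkenhake1992, Lemma 1.1.17] -/
theorem cup_frame_natAdd_eq_zero_of_ne_compl (hqk : 2 * 2 + 2 * 2 = Fintype.card (Fin (2 * 4)))
    (I K : Set.powersetCard (Fin (2 * 4)) (2 * 2)) (h : K ≠ Set.powersetCard.compl hqk I) :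
    cupProduct (show 2 * 2 + 2 * 2 = 2 * 4 from rfl)
        (monB b (2 * 2) (Set.powersetCard.map (2 * 2) (Fin.natAddEmb (2 * 4)) K))
        (monB b (2 * 2) (Set.powersetCard.map (2 * 2) (Fin.natAddEmb (2 * 4)) I)) = 0 := by
  obtain ⟨j, hjK, hjI⟩ := exists_mem_mem_of_ne_compl hqk I K h
  refine CYFormSquare.cupProduct_monB_monB_eq_zero_of_mem _ _ _ _ (j := Fin.natAdd (2 * 4) j) ?_ ?_
  · rw [Set.powersetCard.val_map]; exact Finset.mem_map_of_mem _ hjK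
  · rw [Set.powersetCard.val_map]; exact Finset.mem_map_of_mem _ hjI

/-- **Graded commutativity in degree `4 + 4`**: `x ∪ y = y ∪ x` for `x, y ∈ H⁴(A(ℂ); ℂ)` (`(-1)^{16} = 1`).
[cite: HatcherAT2002, Thm. 3.11] -/
theorem cupProduct_comm_four (x y : complexBetti A.X (2 * 2)) :
    cupProduct (show 2 * 2 + 2 * 2 = 2 * 4 from rfl) x y = cupProduct (show 2 * 2 + 2 * 2 = 2 * 4 from rfl) y x := by
  rw [cupProduct_gradedComm_holds ℂ (ComplexPoints A.X) (show 2 * 2 + 2 * 2 = 2 * 4 from rfl)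
    (show 2 * 2 + 2 * 2 = 2 * 4 from rfl) x y]
  norm_num

/-! ## §4 The pairing `β` is diagonal in every frame -/

include hb hd hA hφ e ha ha0 in
/-- **`β(w_I, w^*_K) = 0` for `I ≠ K` in ANY Weil frame** under `Hg = SU_H`: the torus element of `SU_H(ℂ)` with
weights `2` at `i₀ ∈ I ∖ K`, `2⁻¹` at `i₁ ∈ K ∖ I` (in the frame `w`) multiplies the pair by `4 ≠ 1`, and
`β(x, y) = tr((x ∪ y) ∪ h_K⁴)` is `SU_H(ℂ)`-invariant (helper file 8). [cite: vanGeemen1994HodgeAV, Lemma 6.10 and proof of Thm. 6.12]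
[cite: FriedmanLaza2013, §3.5 Lemma 36] -/
theorem beta_frame_eq_zero_of_ne (hSU : HasHodgeGroupSU A φ 4 d (hK d φ e a))
    (I K : Set.powersetCard (Fin (2 * 4)) (2 * 2)) (hIK : I ≠ K) :
    topCoord (dim_eq_seven_add_one hA)
        (cupProduct (show 2 * 4 + 2 * 4 = 2 + 2 * 7 from rfl)
          (cupProduct (show 2 * 2 + 2 * 2 = 2 * 4 from rfl)
            (monB b (2 * 2) (Set.powersetCard.map (2 * 2) (Fin.castAddEmb (2 * 4)) I))
            (monB b (2 * 2) (Set.powersetCard.map (2 * 2) (Fin.natAddEmb (2 * 4)) K)))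
          (cupPowTwo (hK d φ e a) 4)) = 0 := by
  obtain ⟨i₀, i₁, hne, hw⟩ := exists_torusWeight_castAdd_mul_natAdd_ne_one I K hIK
  set u := torusAuto (m := 2 * 4 - 1) (k := 2 * 4) (by omega) (by omega) hd hφ e ha ha0 w i₀ i₁ with hudef
  have hu : u ∈ weilSpecialUnitaryGroup A φ 4 d (hK d φ e a) :=
    torusAuto_mem (m := 2 * 4 - 1) (by omega) (by omega) hd hφ e ha ha0 w 4 d (by omega) rfl hne
  have hinv := beta_extAct_eq (by omega) hd hA hφ e ha ha0 hSU hu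
    (monB b (2 * 2) (Set.powersetCard.map (2 * 2) (Fin.castAddEmb (2 * 4)) I))
    (monB b (2 * 2) (Set.powersetCard.map (2 * 2) (Fin.natAddEmb (2 * 4)) K))
  have h1 : extAct (u : complexBetti A.X 1 →ₗ[ℂ] complexBetti A.X 1) (2 * 2)
      (monB b (2 * 2) (Set.powersetCard.map (2 * 2) (Fin.castAddEmb (2 * 4)) I)) =
      torusWeight i₀ i₁ (Set.powersetCard.map (2 * 2) (Fin.castAddEmb (2 * 4)) I).val •
        monB b (2 * 2) (Set.powersetCard.map (2 * 2) (Fin.castAddEmb (2 * 4)) I) := by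
    rw [hb]; exact extAct_torusAuto_monB (m := 2 * 4 - 1) (by omega) (by omega) hd hφ e ha ha0 w i₀ i₁ (2 * 2) _
  have h2 : extAct (u : complexBetti A.X 1 →ₗ[ℂ] complexBetti A.X 1) (2 * 2)
      (monB b (2 * 2) (Set.powersetCard.map (2 * 2) (Fin.natAddEmb (2 * 4)) K)) =
      torusWeight i₀ i₁ (Set.powersetCard.map (2 * 2) (Fin.natAddEmb (2 * 4)) K).val •
        monB b (2 * 2) (Set.powersetCard.map (2 * 2) (Fin.natAddEmb (2 * 4)) K) := by
    rw [hb]; exact extAct_torusAuto_monB (m := 2 * 4 - 1) (by omega) (by omega) hd hφ e ha ha0 w i₀ i₁ (2 * 2) _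
  rw [h1, h2] at hinv
  simp only [map_smul, LinearMap.smul_apply, smul_eq_mul] at hinv
  set B := topCoord (dim_eq_seven_add_one hA)
        (cupProduct (show 2 * 4 + 2 * 4 = 2 + 2 * 7 from rfl)
          (cupProduct (show 2 * 2 + 2 * 2 = 2 * 4 from rfl)
            (monB b (2 * 2) (Set.powersetCard.map (2 * 2) (Fin.castAddEmb (2 * 4)) I))
            (monB b (2 * 2) (Set.powersetCard.map (2 * 2) (Fin.natAddEmb (2 * 4)) K)))
          (cupPowTwo (hK d φ e a) 4)) with hB
  have h' : (torusWeight i₀ i₁ (Set.powersetCard.map (2 * 2) (Fin.castAddEmb (2 * 4)) I).val *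
      torusWeight i₀ i₁ (Set.powersetCard.map (2 * 2) (Fin.natAddEmb (2 * 4)) K).val - 1) * B = 0 := by
    linear_combination hinv
  exact (mul_eq_zero.1 h').resolve_left (sub_ne_zero.2 hw)

include hb hd hA hφ e ha ha0 in
/-- `β` in the other order: **`tr((w^*_K ∪ w_I) ∪ h_K⁴) = 0` for `I ≠ K`** in any frame (graded commutativity).
[cite: vanGeemen1994HodgeAV, proof of Thm. 6.12] -/
theorem beta'_frame_eq_zero_of_ne (hSU : HasHodgeGroupSU A φ 4 d (hK d φ e a))
    (I K : Set.powersetCard (Fin (2 * 4)) (2 * 2)) (hIK : I ≠ K) :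
    topCoord (dim_eq_seven_add_one hA)
        (cupProduct (show 2 * 4 + 2 * 4 = 2 + 2 * 7 from rfl)
          (cupProduct (show 2 * 2 + 2 * 2 = 2 * 4 from rfl)
            (monB b (2 * 2) (Set.powersetCard.map (2 * 2) (Fin.natAddEmb (2 * 4)) K))
            (monB b (2 * 2) (Set.powersetCard.map (2 * 2) (Fin.castAddEmb (2 * 4)) I)))
          (cupPowTwo (hK d φ e a) 4)) = 0 := by
  rw [cupProduct_comm_four]
  exact beta_frame_eq_zero_of_ne hd hA hφ e ha ha0 w b hb hSU I K hIK

end Frame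

end Summit.HodgeConjecture.HodgeConjecture.Theorems.CYFormCarrier

end
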